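import Summits.BirchSwinnertonDyer.BirchSwinnertonDyer.Theorems.ClassRecordThreeCornerAtThreeControlOfFacts
import Summits.BirchSwinnertonDyer.BirchSwinnertonDyer.Theorems.ClassRecordThreeCornerAtThreeCoChainDefs

/-!
# BC3 kit (PRE-BIRTH form) — crux child `CornerAtThreeUpper` of `ClassRecordThree.CornerAtThree`
# (item stmt-BirchSwinnertonDyer-19111; registered stub `stub_cornerUpper3` of `Lines/birth.lean` 12ed36782b0e)
# along the CO-CHAIN road, v2 (stub BY NAME) — line `Lines/cochain.lean` (width-lever second lane `bsd-stepL-corner3-p2`, g0)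

THE CUT = this lane's kernel theorem `X11b.Three.cornerAtThreeUpper_of_coIMC_of_facts`
(`Theorems/ClassRecordThreeCornerAtThreeControlOfFacts.lean`, p528380): `Theorems.CornerAtThreeUpper` (= `∀ W,
Three.CornerUpperAt W`, the Tamagawa-SHARP Kolyvagin bound over `K` on the ¬Surj corner at `3`) ⟸
{(U1) the Kolyvagin-SYSTEM («⊇») half of the anticyclotomic BDP main conjecture at `𝟙` on the corner frames —
`ord₃ f_ac(0) ≤ 2(ord₃ log_ω P − 1)` on the constructed `X_ac` — ONE open stub `stub_upper3_coStepL : Theorems.CornerAtThreeCoStepL` (BY NAME;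
`Theorems/ClassRecordThreeCornerAtThreeCoChainDefs.lean`, p530129 ✓)} + {four CITED facts by name — stub `stub_upper3_ctlFacts`: GZK, `exists_isNewformOf`,
Poitou–Tate for Selmer structures and for `Ш`}, the anticyclotomic CONTROL identity (the Tamagawa term) being a
THEOREM at every corner frame (`X11b.controlOnTreeAt_of_mult_of_rankOne_odd`). TIGHT: (U1) ⟺ the child modulo cited
facts (`Three.cornerCoIMC_iff_cornerUpperAt_of_facts`, p529295). Compare the J₃ᶜ kit of corner-p1 g7
(`HOME/corner/g7/bc3/CornerAtThreeUpper_birth.lean`: stubs inputs ∕ jetchevMax ∕ jetchevMulti): a DIFFERENT road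
(classical Kolyvagin + Jetchev global divisibility); the two kits are alternatives for the same child.
Nothing is asserted about any curve (T7); sorries only in `stub_*`.
-/

set_option linter.dupNamespace false
set_option autoImplicit false

noncomputable section

open scoped Classical

namespace Summit.BirchSwinnertonDyer.BirchSwinnertonDyer.Cruxes.CornerAtThreeUpper.CoChain

open WeierstrassCurve NumberField IsDedekindDomain Field Literature.NumberTheory.EllipticCurves
  Literature.NumberTheory.EllipticCurves.ModularForms Literature.NumberTheory.GaloisCohomology
  Literature.NumberTheory.EllipticCurves.Rank1Residual Summit.BirchSwinnertonDyer.Rank1Residual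
  Summit.BirchSwinnertonDyer.Rank1Residual.X11b Summit.BirchSwinnertonDyer.Rank1Residual.X11b.AcSelmer

/-- **stub (U1) — `Theorems.CornerAtThreeCoStepL` BY NAME** (p530129: `∀ W, Three.CornerCoStepLAt W`, the
Kolyvagin-SYSTEM («⊇») half of the anticyclotomic BDP main conjecture at `𝟙` on the corner frames): OPEN — Howard 2004
Thm. B ∕ BCK21 ∕ BCS24 need (sur) or exclude dihedral primes and `p = 3`; [BS24] (dihedral primes) unavailable. -/
theorem stub_upper3_coStepL : Summit.BirchSwinnertonDyer.BirchSwinnertonDyer.Theorems.CornerAtThreeCoStepL := by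
  sorry

/-- **stub (cited facts, by name)** — GZK, newforms, Poitou–Tate for Selmer structures and for `Ш` (all `def … : Prop`
facts of Literature; never «proved» here; the planner may move them into the route's support bundle). -/
theorem stub_upper3_ctlFacts :
    rank_eq_analyticRank_of_analyticRank_le_one ∧ exists_isNewformOf ∧
    (∀ (K : Type) [Field K] [NumberField K], poitouTate_selmerStructure_duality K) ∧
    (∀ (K : Type) [Field K] [NumberField K], poitouTate_sha_tateDual K) := by
  sorry

/-! ## Stub statements by name -/

namespace Statement

/-- Statement of `stub_upper3_coStepL`. -/
abbrev stub_upper3_coStepL : Prop := type_of% @CoChain.stub_upper3_coStepL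
/-- Statement of `stub_upper3_ctlFacts`. -/
abbrev stub_upper3_ctlFacts : Prop := type_of% @CoChain.stub_upper3_ctlFacts

end Statement

/-! ## The composition (sorry-free): the two stub STATEMENTS imply the child, BY NAME -/

/-- **`CornerAtThreeUpper_of`** — this lane's `Three.cornerAtThreeUpper_of_cornerAtThreeCoStepL_of_facts` (p532389), spelled out
over `Three.cornerAtThreeUpper_of_coIMC_of_facts` (p528380). -/
theorem CornerAtThreeUpper_of (hco : Statement.stub_upper3_coStepL) (hF : Statement.stub_upper3_ctlFacts) :
    Summit.BirchSwinnertonDyer.BirchSwinnertonDyer.Theorems.CornerAtThreeUpper :=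
  haveI : Fact (Nat.Prime 3) := ⟨Nat.prime_three⟩
  -- = `Three.cornerAtThreeUpper_of_cornerAtThreeCoStepL_of_facts hF.1 hF.2.1 hF.2.2.1 hF.2.2.2 hco` (p532389); spelled
  -- out over p528380 so that the kit elaborates on farm snapshots that predate the by-name module
  Three.cornerAtThreeUpper_of_coIMC_of_facts hF.1 hF.2.1 hF.2.2.1 hF.2.2.2
    (fun W _ _ N _ K _ _ Dt H ι P hX hns _ hN hK hodd hHN hLt hP hc hPinf κ hκ γ _ 𝔭 h𝔭 he hf ↦
      hco W N K Dt H ι P hX hns hN hK hodd hHN hLt hP hc hPinf κ hκ γ 𝔭 h𝔭 he hf)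

/-- The child along this line, MODULO exactly the two stubs (sorries only in `stub_*`). -/
theorem CornerAtThreeUpper_proof : Summit.BirchSwinnertonDyer.BirchSwinnertonDyer.Theorems.CornerAtThreeUpper :=
  CornerAtThreeUpper_of stub_upper3_coStepL stub_upper3_ctlFacts

end Summit.BirchSwinnertonDyer.BirchSwinnertonDyer.Cruxes.CornerAtThreeUpper.CoChain

end
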